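import Mathlib.Algebra.BigOperators.Module
import Mathlib.NumberTheory.Chebyshev
import Mathlib.Analysis.Complex.ExponentialBounds
import Literature.NumberTheory.LFunctions.GaussianHeckePrimeSums
import Literature.NumberTheory.LFunctions.GaussianVonMangoldtBound
import HarnessLib

/-!
# From `∑_{n ≤ N} l_m(n) f(n)` to `∑_{R ≤ N(p) < S} λ^m(p) N(p)^{it}`: bookkeeping for Harman's Lemma 11.6

Topic `Literature/NumberTheory/LFunctions`.  Elementary identities and bounds (all PROVED, no
definitions) linking the prime-power sums controlled analytically in `GaussianHeckeTwistedSum.lean` to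
Harman's prime character sum `Literature.NumberTheory.LFunctions.GaussianInt.primeCharSum`
(*Prime-Detecting Sieves*, (11.4.5)):

* `sum_lCoeff_mul_eq_sum_ppairs` — `∑_{n ≤ N} l_m(n) f(n) = ∑_{N(π)^j ≤ N} log N(π) λ^m(π)^j f(N(π)^j)`
  (weighted form of `GaussianHecke.sum_lCoeff_eq_sum_ppairs`);
* `norm_sum_lCoeff_mul_sub_primeSum_le` — prime powers `j ≥ 2` cost `≤ 9√N log₂N log N` when `|f| ≤ 1`;
* `norm_sum_Icc_mul_le_of_antitone` — **Abel summation**: `‖∑_{N₁ ≤ n ≤ N₂} w(n) a(n)‖ ≤ 2M w(N₁)` for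
  `w ≥ 0` non-increasing and partial sums of `a` bounded by `M` (Mathlib's `Finset.sum_Ioc_by_parts`);
* `sum_range_fiber_eq_primeSum`, `primeCharSum_eq_sum_Icc` — Harman's sum as
  `∑_{⌈R⌉ ≤ n ≤ ⌈S⌉-1} (log n)⁻¹ a(n)` with `a(n) = ∑_{N(π) = n} log n · λ^m(π) n^{it}`, whose partial
  sums are the twisted `θ`-sums `∑_{N(π) ≤ N} log N(π) λ^m(π) N(π)^{it}`;
* trivial bounds: `thetaReal_le` (`Θ_{ℤ[i]}(N) ≤ 2ψ(N) ≤ 12N`, via `Λ_{ℤ[i]} ≤ 2Λ` and Mathlib's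
  Chebyshev bound), `norm_primeSum_le_thetaReal`, `norm_primeCharSum_le` (`≤ 9S`).

## References

* G. Harman, *Prime-Detecting Sieves*, Princeton UP 2007, §11.4, Lemma 11.6. [Harman2007]
-/

noncomputable section

open Complex Finset
open scoped ArithmeticFunction.vonMangoldt

namespace Literature.NumberTheory.LFunctions

namespace GaussianHecke

open GaussianInt

/-! ### Weighted prime-power sums -/

/-- **`∑_{n ≤ N} l_m(n) f(n) = ∑_{(π,j) : N(π)^j ≤ N} log N(π) λ^m(π)^j f(N(π)^j)`.** [folklore] -/
theorem sum_lCoeff_mul_eq_sum_ppairs (m N : ℕ) (f : ℕ → ℂ) :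
    ∑ n ∈ Icc 1 N, lCoeff m n * f n =
      ∑ p ∈ ppairs N, (Real.log (p.1.norm : ℝ) : ℂ) * angularChar m p.1 ^ p.2 *
        f (p.1.norm.natAbs ^ p.2) := by
  have hmaps : ∀ p ∈ ppairs N, p.1.norm.natAbs ^ p.2 ∈ Icc 1 N := by
    intro p hp
    obtain ⟨hπ, hj, hle⟩ := mem_ppairs.mp hp
    refine mem_Icc.mpr ⟨Nat.one_le_pow _ _ ?_, hle⟩
    have := two_le_norm_of_prime (mem_primesQ1.mp hπ).1
    have := natAbs_norm_cast p.1
    omega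
  rw [← sum_fiberwise_of_maps_to hmaps]
  refine sum_congr rfl fun n hn ↦ ?_
  rw [lCoeff, sum_mul]
  have hfib : (ppairs N).filter (fun p ↦ p.1.norm.natAbs ^ p.2 = n) = pairsNorm n := by
    ext p
    obtain ⟨hn1, hnN⟩ := mem_Icc.mp hn
    rw [mem_filter, mem_ppairs, mem_pairsNorm]
    constructor
    · rintro ⟨⟨hπ, hj, -⟩, hpn⟩
      obtain ⟨hP, hQ, -⟩ := mem_primesQ1.mp hπ
      have key := mem_pairsNorm.mp (mem_pairsNorm_of hP hQ (mem_Icc.mp hj).1)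
      rw [hpn] at key
      exact ⟨key.1, key.2.1, hpn⟩
    · rintro ⟨hπ, hj, hpn⟩
      obtain ⟨hP, hQ, hle⟩ := mem_primesQ1.mp hπ
      obtain ⟨hj1, hjn⟩ := mem_Icc.mp hj
      exact ⟨⟨mem_primesQ1.mpr ⟨hP, hQ, hle.trans (by exact_mod_cast hnN)⟩,
        mem_Icc.mpr ⟨hj1, hjn.trans hnN⟩, hpn ▸ hnN⟩, hpn⟩
  rw [hfib]
  refine sum_congr rfl fun p hp ↦ ?_
  rw [(mem_pairsNorm.mp hp).2.2]

/-- The `j = 1` slice of the weighted sum is the weighted prime sum. [folklore] -/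
theorem sum_ppairs_filter_one_eq (m N : ℕ) (f : ℕ → ℂ) :
    ∑ p ∈ (ppairs N).filter (fun p ↦ p.2 = 1),
        (Real.log (p.1.norm : ℝ) : ℂ) * angularChar m p.1 ^ p.2 * f (p.1.norm.natAbs ^ p.2) =
      ∑ π ∈ primesQ1 N, (Real.log (π.norm : ℝ) : ℂ) * angularChar m π * f π.norm.natAbs := by
  refine sum_nbij' (fun p ↦ p.1) (fun π ↦ (π, 1)) ?_ ?_ ?_ ?_ ?_
  · intro p hp
    exact (mem_ppairs.mp (mem_filter.mp hp).1).1
  · intro π hπ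
    obtain ⟨hP, hQ, hle⟩ := mem_primesQ1.mp hπ
    have hN : 1 ≤ N := by
      have := two_le_norm_of_prime hP; omega
    refine mem_filter.mpr ⟨mem_ppairs.mpr ⟨hπ, mem_Icc.mpr ⟨le_rfl, hN⟩, ?_⟩, rfl⟩
    have := natAbs_norm_cast π
    show π.norm.natAbs ^ 1 ≤ N
    rw [pow_one]; omega
  · rintro ⟨π, j⟩ hp
    have hj : j = 1 := (mem_filter.mp hp).2
    simp [hj]
  · intro π _; rfl
  · rintro ⟨π, j⟩ hp
    have hj : j = 1 := (mem_filter.mp hp).2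
    simp [hj]

/-- **Prime powers with `j ≥ 2` are negligible**: for `|f| ≤ 1`,
`‖∑_{n ≤ N} l_m(n) f(n) - ∑_{N(π) ≤ N} log N(π) λ^m(π) f(N(π))‖ ≤ 9 √N log₂N log N`. [folklore] -/
theorem norm_sum_lCoeff_mul_sub_primeSum_le (m : ℕ) {N : ℕ} (hN : 1 ≤ N) (f : ℕ → ℂ)
    (hf : ∀ n, ‖f n‖ ≤ 1) :
    ‖∑ n ∈ Icc 1 N, lCoeff m n * f n -
        ∑ π ∈ primesQ1 N, (Real.log (π.norm : ℝ) : ℂ) * angularChar m π * f π.norm.natAbs‖ ≤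
      9 * Nat.sqrt N * Nat.log 2 N * Real.log N := by
  rw [sum_lCoeff_mul_eq_sum_ppairs, ← sum_ppairs_filter_one_eq m N f,
    ← sum_filter_add_sum_filter_not (ppairs N) (fun p ↦ p.2 = 1), add_sub_cancel_left]
  have hbound : ∀ p ∈ (ppairs N).filter (fun p ↦ ¬p.2 = 1),
      ‖(Real.log (p.1.norm : ℝ) : ℂ) * angularChar m p.1 ^ p.2 * f (p.1.norm.natAbs ^ p.2)‖ ≤
        Real.log N := by
    intro p hp
    obtain ⟨hπ, -, hle⟩ := mem_ppairs.mp (mem_filter.mp hp).1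
    obtain ⟨hP, -, hleN⟩ := mem_primesQ1.mp hπ
    have h1 : (1 : ℝ) ≤ (p.1.norm : ℝ) := by
      have := two_le_norm_of_prime hP; exact_mod_cast (by omega : (1 : ℤ) ≤ p.1.norm)
    rw [norm_mul, norm_mul, norm_pow, norm_angularChar hP.ne_zero, one_pow, mul_one, Complex.norm_real,
      Real.norm_of_nonneg (Real.log_nonneg h1)]
    calc Real.log (p.1.norm : ℝ) * ‖f (p.1.norm.natAbs ^ p.2)‖ ≤ Real.log (p.1.norm : ℝ) * 1 :=
          mul_le_mul_of_nonneg_left (hf _) (Real.log_nonneg h1)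
      _ ≤ Real.log N := by
          rw [mul_one]; exact Real.log_le_log (by linarith) (by exact_mod_cast hleN)
  calc ‖∑ p ∈ (ppairs N).filter (fun p ↦ ¬p.2 = 1),
        (Real.log (p.1.norm : ℝ) : ℂ) * angularChar m p.1 ^ p.2 * f (p.1.norm.natAbs ^ p.2)‖
      ≤ ∑ p ∈ (ppairs N).filter (fun p ↦ ¬p.2 = 1), Real.log N :=
        (norm_sum_le _ _).trans (sum_le_sum hbound)
    _ = ((ppairs N).filter (fun p ↦ ¬p.2 = 1)).card * Real.log N := by rw [sum_const, nsmul_eq_mul]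
    _ ≤ (9 * Nat.sqrt N * Nat.log 2 N) * Real.log N := by
        refine mul_le_mul_of_nonneg_right ?_ (Real.log_natCast_nonneg N)
        have hsub := ppairs_filter_subset N
        have hc := (card_le_card hsub).trans_eq (card_product _ _)
        rw [Nat.card_Icc] at hc
        have hq : ((primesQ1 (Nat.sqrt N)).card : ℝ) ≤ 9 * Nat.sqrt N :=
          (Nat.cast_le.mpr (card_primesQ1_le _)).trans
            (card_normLE_le_nine_mul (Nat.le_sqrt.mpr (by omega)))
        have hl : ((Nat.log 2 N + 1 - 2 : ℕ) : ℝ) ≤ Nat.log 2 N := by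
          norm_cast
          omega
        calc (((ppairs N).filter (fun p ↦ ¬p.2 = 1)).card : ℝ)
            ≤ (primesQ1 (Nat.sqrt N)).card * ((Nat.log 2 N + 1 - 2 : ℕ) : ℝ) := by exact_mod_cast hc
          _ ≤ (9 * Nat.sqrt N) * Nat.log 2 N :=
              mul_le_mul hq hl (Nat.cast_nonneg _) (by positivity)

/-- `9 √N log₂N log N ≤ 13 √N (log N)²` as real numbers (`log₂ N ≤ log N / log 2`, `9/log 2 < 13`).
[folklore] -/
theorem nine_sqrt_log_le (N : ℕ) :
    (9 * Nat.sqrt N * Nat.log 2 N * Real.log N : ℝ) ≤ 13 * Real.sqrt N * Real.log N ^ 2 := by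
  rcases Nat.eq_zero_or_pos N with rfl | hN
  · simp
  have hlog2 : (9 : ℝ) / 13 < Real.log 2 := by
    have := Real.log_two_gt_d9; linarith
  have hlog2pos : 0 < Real.log 2 := by linarith
  have hlogN : 0 ≤ Real.log N := Real.log_natCast_nonneg N
  have hsqrt : (Nat.sqrt N : ℝ) ≤ Real.sqrt N := Real.nat_sqrt_le_real_sqrt
  have hNlog : (Nat.log 2 N : ℝ) ≤ Real.log N / Real.log 2 := by
    rw [← Real.natFloor_logb_natCast 2 N, Real.log_div_log]
    exact Nat.floor_le (Real.logb_nonneg one_lt_two (by exact_mod_cast hN))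
  have h913 : 9 / Real.log 2 ≤ 13 := by
    rw [div_le_iff₀ hlog2pos]; linarith
  calc (9 * Nat.sqrt N * Nat.log 2 N * Real.log N : ℝ)
      ≤ 9 * Real.sqrt N * (Real.log N / Real.log 2) * Real.log N := by gcongr
    _ = (9 / Real.log 2) * (Real.sqrt N * Real.log N ^ 2) := by
        field_simp
    _ ≤ 13 * (Real.sqrt N * Real.log N ^ 2) := mul_le_mul_of_nonneg_right h913 (by positivity)
    _ = 13 * Real.sqrt N * Real.log N ^ 2 := by ring

/-! ### Abel summation -/

/-- Telescoping over `Ico`: `∑_{i ∈ [a, b)} (w(i) - w(i+1)) = w(a) - w(b)`. [folklore] -/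
theorem sum_Ico_sub_succ (w : ℕ → ℝ) {a b : ℕ} (hab : a ≤ b) :
    ∑ i ∈ Ico a b, (w i - w (i + 1)) = w a - w b := by
  rw [sum_Ico_eq_sub _ hab, sum_range_sub', sum_range_sub']
  ring

/-- **Abel summation bound.** If `w ≥ 0` is non-increasing on `[N₁, N₂]` (`N₁ ≥ 1`) and the partial sums
`‖∑_{i < k} a(i)‖ ≤ M` for `N₁ ≤ k ≤ N₂ + 1`, then `‖∑_{N₁ ≤ n ≤ N₂} w(n) a(n)‖ ≤ 2 M w(N₁)`
(summation by parts, Mathlib's `Finset.sum_Ioc_by_parts`). [folklore] -/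
theorem norm_sum_Icc_mul_le_of_antitone {a : ℕ → ℂ} {w : ℕ → ℝ} {N₁ N₂ : ℕ} {M : ℝ}
    (hN₁ : 1 ≤ N₁) (h12 : N₁ ≤ N₂)
    (hw : ∀ i, N₁ ≤ i → i < N₂ → w (i + 1) ≤ w i) (hw0 : 0 ≤ w N₂)
    (hM : ∀ k, N₁ ≤ k → k ≤ N₂ + 1 → ‖∑ i ∈ range k, a i‖ ≤ M) :
    ‖∑ n ∈ Icc N₁ N₂, (w n : ℂ) * a n‖ ≤ 2 * M * w N₁ := by
  have hM0 : 0 ≤ M := le_trans (norm_nonneg _) (hM N₁ le_rfl (by omega))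
  -- `w` is non-increasing along the whole range, hence `w i ≥ w N₂ ≥ 0`
  have hmono : ∀ i j, N₁ ≤ i → i ≤ j → j ≤ N₂ → w j ≤ w i := by
    intro i j hi hij hj
    induction j, hij using Nat.le_induction with
    | base => exact le_rfl
    | succ k hik ih => exact (hw k (by omega) (by omega)).trans (ih (by omega))
  have hwnn : ∀ i, N₁ ≤ i → i ≤ N₂ → 0 ≤ w i := fun i hi hiN ↦ hw0.trans (hmono i N₂ hi hiN le_rfl)
  -- summation by parts on `Ioc (N₁ - 1) N₂ = Icc N₁ N₂`
  have hIcc : Icc N₁ N₂ = Ioc (N₁ - 1) N₂ := by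
    ext i; simp only [mem_Icc, mem_Ioc]; omega
  have hsmul : ∀ n, (w n : ℂ) * a n = w n • a n := fun n ↦ by rw [Complex.real_smul]
  simp_rw [hIcc, hsmul]
  rw [sum_Ioc_by_parts (f := w) (g := a) (by omega : N₁ - 1 < N₂)]
  have hN₁' : N₁ - 1 + 1 = N₁ := by omega
  rw [hN₁']
  -- bound the three pieces
  have h1 : ‖w N₂ • ∑ i ∈ range (N₂ + 1), a i‖ ≤ w N₂ * M := by
    rw [norm_smul, Real.norm_of_nonneg hw0]
    exact mul_le_mul_of_nonneg_left (hM _ (by omega) le_rfl) hw0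
  have h2 : ‖w N₁ • ∑ i ∈ range N₁, a i‖ ≤ w N₁ * M := by
    rw [norm_smul, Real.norm_of_nonneg (hwnn N₁ le_rfl h12)]
    exact mul_le_mul_of_nonneg_left (hM _ le_rfl (by omega)) (hwnn N₁ le_rfl h12)
  have h3 : ‖∑ i ∈ Ioc (N₁ - 1) (N₂ - 1), (w (i + 1) - w i) • ∑ j ∈ range (i + 1), a j‖ ≤
      (w N₁ - w N₂) * M := by
    have hIoc : Ioc (N₁ - 1) (N₂ - 1) = Ico N₁ N₂ := by
      ext i; simp only [mem_Ioc, mem_Ico]; omega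
    rw [hIoc]
    calc ‖∑ i ∈ Ico N₁ N₂, (w (i + 1) - w i) • ∑ j ∈ range (i + 1), a j‖
        ≤ ∑ i ∈ Ico N₁ N₂, ‖(w (i + 1) - w i) • ∑ j ∈ range (i + 1), a j‖ := norm_sum_le _ _
      _ ≤ ∑ i ∈ Ico N₁ N₂, (w i - w (i + 1)) * M := by
          refine sum_le_sum fun i hi ↦ ?_
          obtain ⟨hi1, hi2⟩ := mem_Ico.mp hi
          have hd : 0 ≤ w i - w (i + 1) := sub_nonneg.mpr (hw i hi1 hi2)
          rw [norm_smul, Real.norm_eq_abs, abs_sub_comm, abs_of_nonneg hd]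
          exact mul_le_mul_of_nonneg_left (hM _ (by omega) (by omega)) hd
      _ = (w N₁ - w N₂) * M := by rw [← sum_mul, sum_Ico_sub_succ w h12]
  calc ‖w N₂ • ∑ i ∈ range (N₂ + 1), a i - w N₁ • ∑ i ∈ range N₁, a i -
        ∑ i ∈ Ioc (N₁ - 1) (N₂ - 1), (w (i + 1) - w i) • ∑ j ∈ range (i + 1), a j‖
      ≤ ‖w N₂ • ∑ i ∈ range (N₂ + 1), a i‖ + ‖w N₁ • ∑ i ∈ range N₁, a i‖ +
          ‖∑ i ∈ Ioc (N₁ - 1) (N₂ - 1), (w (i + 1) - w i) • ∑ j ∈ range (i + 1), a j‖ :=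
        (norm_sub_le _ _).trans (add_le_add (norm_sub_le _ _) le_rfl)
    _ ≤ w N₂ * M + w N₁ * M + (w N₁ - w N₂) * M := by linarith
    _ = 2 * M * w N₁ := by ring

/-! ### Harman's sum, grouped by the norm -/

/-- The first-quadrant primes of norm exactly `n`, inside any `primesQ1 B` with `B ≥ n`. [folklore] -/
theorem filter_primesQ1_norm_eq {B n : ℕ} (hnB : n ≤ B) :
    (primesQ1 B).filter (fun π ↦ π.norm.natAbs = n) = (primesQ1 n).filter (fun π ↦ π.norm.natAbs = n) := by
  ext π
  simp only [mem_filter, mem_primesQ1]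
  constructor
  · rintro ⟨⟨hP, hQ, -⟩, hn⟩
    refine ⟨⟨hP, hQ, ?_⟩, hn⟩
    rw [← natAbs_norm_cast π, hn]
  · rintro ⟨⟨hP, hQ, -⟩, hn⟩
    refine ⟨⟨hP, hQ, ?_⟩, hn⟩
    rw [← natAbs_norm_cast π, hn]
    exact_mod_cast hnB

/-- **Partial sums of `a(n) = ∑_{N(π) = n} log N(π) λ^m(π) f(N(π))` are the weighted `θ`-sums**:
`∑_{i < k} a(i) = ∑_{π ∈ primesQ1 (k - 1)} log N(π) λ^m(π) f(N(π))`. [folklore] -/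
theorem sum_range_fiber_eq_primeSum (m : ℕ) (f : ℕ → ℂ) (k : ℕ) :
    ∑ n ∈ range k, ∑ π ∈ (primesQ1 n).filter (fun π ↦ π.norm.natAbs = n),
        (Real.log (π.norm : ℝ) : ℂ) * angularChar m π * f π.norm.natAbs =
      ∑ π ∈ primesQ1 (k - 1), (Real.log (π.norm : ℝ) : ℂ) * angularChar m π * f π.norm.natAbs := by
  rcases Nat.eq_zero_or_pos k with rfl | hk
  · simp only [range_zero, sum_empty, Nat.zero_sub]
    symm
    refine sum_eq_zero fun π hπ ↦ ?_
    obtain ⟨hP, -, hle⟩ := mem_primesQ1.mp hπ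
    have := two_le_norm_of_prime hP
    push_cast at hle
    omega
  have hmaps : ∀ π ∈ primesQ1 (k - 1), π.norm.natAbs ∈ range k := by
    intro π hπ
    obtain ⟨-, -, hle⟩ := mem_primesQ1.mp hπ
    rw [mem_range]
    have := natAbs_norm_cast π
    omega
  rw [← sum_fiberwise_of_maps_to hmaps]
  refine sum_congr rfl fun n hn ↦ ?_
  rw [filter_primesQ1_norm_eq (B := k - 1) (n := n) (by rw [mem_range] at hn; omega)]

/-- The terms of the grouped sum vanish for `n ≤ 1`, and have norm `≤ log n · #(fiber)`; the whole
weighted `θ`-sum is bounded by `Θ_{ℤ[i]}(N)` when `|f| ≤ 1`. [folklore] -/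
theorem norm_primeSum_le_thetaReal (m N : ℕ) (f : ℕ → ℂ) (hf : ∀ n, ‖f n‖ ≤ 1) :
    ‖∑ π ∈ primesQ1 N, (Real.log (π.norm : ℝ) : ℂ) * angularChar m π * f π.norm.natAbs‖ ≤ thetaReal N := by
  rw [thetaReal]
  refine (norm_sum_le _ _).trans (sum_le_sum fun π hπ ↦ ?_)
  obtain ⟨hP, -, -⟩ := mem_primesQ1.mp hπ
  have h1 : (1 : ℝ) ≤ (π.norm : ℝ) := by
    have := two_le_norm_of_prime hP; exact_mod_cast (by omega : (1 : ℤ) ≤ π.norm)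
  rw [norm_mul, norm_mul, norm_angularChar hP.ne_zero, mul_one, Complex.norm_real,
    Real.norm_of_nonneg (Real.log_nonneg h1)]
  calc Real.log (π.norm : ℝ) * ‖f π.norm.natAbs‖ ≤ Real.log (π.norm : ℝ) * 1 :=
        mul_le_mul_of_nonneg_left (hf _) (Real.log_nonneg h1)
    _ = Real.log (π.norm : ℝ) := mul_one _

/-- **`Θ_{ℤ[i]}(N) ≤ 2 ψ(N)`**: `Θ(N) ≤ ∑_{n ≤ N} Λ_{ℤ[i]}(n) ≤ 2 ∑_{n ≤ N} Λ(n)`. [folklore] -/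
theorem thetaReal_le_two_mul_psi (N : ℕ) : thetaReal N ≤ 2 * Chebyshev.psi N := by
  classical
  -- `Θ(N) ≤ ∑_{(π, j) ∈ ppairs N} log N(π) = ∑_{n ≤ N} Λ_{ℤ[i]}(n)`
  have h1 : thetaReal N ≤ ∑ p ∈ ppairs N, Real.log (p.1.norm : ℝ) := by
    rw [thetaReal]
    have hinj : Set.InjOn (fun π : GaussianInt ↦ (π, 1)) (primesQ1 N : Set GaussianInt) :=
      fun π _ π' _ h ↦ (Prod.ext_iff.mp h).1
    have himg : (primesQ1 N).image (fun π ↦ (π, 1)) ⊆ ppairs N := by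
      intro p hp
      obtain ⟨π, hπ, rfl⟩ := mem_image.mp hp
      obtain ⟨hP, hQ, hle⟩ := mem_primesQ1.mp hπ
      have hN : 1 ≤ N := by have := two_le_norm_of_prime hP; omega
      refine mem_ppairs.mpr ⟨hπ, mem_Icc.mpr ⟨le_rfl, hN⟩, ?_⟩
      have := natAbs_norm_cast π
      show π.norm.natAbs ^ 1 ≤ N
      rw [pow_one]; omega
    calc ∑ π ∈ primesQ1 N, Real.log (π.norm : ℝ)
        = ∑ p ∈ (primesQ1 N).image (fun π ↦ (π, 1)), Real.log (p.1.norm : ℝ) := by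
          rw [sum_image hinj]
      _ ≤ ∑ p ∈ ppairs N, Real.log (p.1.norm : ℝ) :=
          sum_le_sum_of_subset_of_nonneg himg fun p hp _ ↦ by
            obtain ⟨hπ, -, -⟩ := mem_ppairs.mp hp
            have := two_le_norm_of_prime (mem_primesQ1.mp hπ).1
            exact Real.log_nonneg (by exact_mod_cast (by omega : (1 : ℤ) ≤ p.1.norm))
  have h2 : (∑ p ∈ ppairs N, Real.log (p.1.norm : ℝ)) = ∑ n ∈ Icc 1 N, coeffZero n := by
    have h := sum_lCoeff_mul_eq_sum_ppairs 0 N (fun _ ↦ 1)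
    simp only [mul_one, angularChar_zero_left, one_pow, ← coeffZero_eq] at h
    exact_mod_cast h.symm
  have h3 : ∑ n ∈ Icc 1 N, coeffZero n ≤ ∑ n ∈ Icc 1 N, 2 * Λ n :=
    sum_le_sum fun n _ ↦ coeffZero_le_two_mul_vonMangoldt n
  have h4 : ∑ n ∈ Icc 1 N, 2 * Λ n = 2 * Chebyshev.psi N := by
    rw [← mul_sum, Chebyshev.psi, Nat.floor_natCast]
    rfl
  linarith

/-- **`Θ_{ℤ[i]}(N) ≤ 12 N`** (Chebyshev: `ψ(N) ≤ (log 4 + 4)N ≤ 6N`). [folklore] -/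
theorem thetaReal_le (N : ℕ) : thetaReal N ≤ 12 * N := by
  have h1 := thetaReal_le_two_mul_psi N
  have h2 := Chebyshev.psi_le_const_mul_self (Nat.cast_nonneg N : (0 : ℝ) ≤ N)
  have hlog4 : Real.log 4 ≤ 2 := by
    have h := Real.log_le_sub_one_of_pos (show (0 : ℝ) < 4 by norm_num)
    have h' : Real.log 4 = 2 * Real.log 2 := by
      rw [show (4 : ℝ) = 2 ^ 2 by norm_num, Real.log_pow]; norm_num
    have := Real.log_two_lt_d9
    linarith
  have hN : (0 : ℝ) ≤ N := Nat.cast_nonneg N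
  nlinarith

/-! ### Harman's `primeCharSum` -/

/-- **Harman's sum grouped by the norm**: for `2 ≤ R` and `0 < S`,
`∑_{R ≤ N(p) < S} N(p)^{it} λ^m(p) = ∑_{n = ⌈R⌉}^{⌈S⌉ - 1} (log n)⁻¹ · a(n)`,
`a(n) = ∑_{N(π) = n} log N(π) λ^m(π) n^{it}`. [cite: Harman2007, Lemma 11.6 (11.4.5)] -/
theorem primeCharSum_eq_sum_Icc {R S : ℝ} (hR : 2 ≤ R) (hS : 0 < S) (m : ℕ) (t : ℝ) :
    primeCharSum R S m t =
      ∑ n ∈ Icc ⌈R⌉₊ (⌈S⌉₊ - 1), ((Real.log n)⁻¹ : ℝ) *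
        ∑ π ∈ (primesQ1 n).filter (fun π ↦ π.norm.natAbs = n),
          (Real.log (π.norm : ℝ) : ℂ) * angularChar m π * ((π.norm.natAbs : ℕ) : ℂ) ^ ((t : ℂ) * I) := by
  classical
  unfold primeCharSum
  set F : Finset GaussianInt := (normLE S).filter (fun p : GaussianInt ↦
      p ∈ firstQuadrant ∧ Prime p ∧ R ≤ (p.norm : ℝ) ∧ (p.norm : ℝ) < S) with hF
  have hcast : ∀ p : GaussianInt, ((p.norm.natAbs : ℕ) : ℝ) = (p.norm : ℝ) := natAbs_norm_real
  have hmaps : ∀ p ∈ F, p.norm.natAbs ∈ Icc ⌈R⌉₊ (⌈S⌉₊ - 1) := by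
    intro p hp
    obtain ⟨-, -, -, hRp, hpS⟩ := mem_filter.mp hp
    rw [mem_Icc]
    constructor
    · exact Nat.ceil_le.mpr (by rw [hcast]; exact hRp)
    · have h1 : (p.norm.natAbs : ℝ) < ⌈S⌉₊ := by
        rw [hcast]; exact lt_of_lt_of_le hpS (Nat.le_ceil S)
      have h2 : p.norm.natAbs < ⌈S⌉₊ := by exact_mod_cast h1
      omega
  rw [← sum_fiberwise_of_maps_to hmaps]
  refine sum_congr rfl fun n hn ↦ ?_
  obtain ⟨hn1, hn2⟩ := mem_Icc.mp hn
  have hR2 : (2 : ℝ) ≤ (⌈R⌉₊ : ℕ) := hR.trans (Nat.le_ceil R)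
  have hn2' : 2 ≤ n := le_trans (by exact_mod_cast hR2) hn1
  have hRn : R ≤ n := Nat.ceil_le.mp hn1
  have hnS : (n : ℝ) < S := by
    have h1 : (⌈S⌉₊ : ℝ) < S + 1 := Nat.ceil_lt_add_one hS.le
    have h2 : 1 ≤ ⌈S⌉₊ := Nat.one_le_iff_ne_zero.mpr (by
      intro h0; rw [h0] at hn2; omega)
    have h3 : ((⌈S⌉₊ - 1 : ℕ) : ℝ) = ⌈S⌉₊ - 1 := by rw [Nat.cast_sub h2]; simp
    have h4 : (n : ℝ) ≤ ((⌈S⌉₊ - 1 : ℕ) : ℝ) := by exact_mod_cast hn2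
    linarith
  have hlogn : Real.log n ≠ 0 := by
    have : (1 : ℝ) < n := by exact_mod_cast (by omega : 1 < n)
    exact (Real.log_pos this).ne'
  -- the fibre
  have hfib : F.filter (fun p ↦ p.norm.natAbs = n) = (primesQ1 n).filter (fun π ↦ π.norm.natAbs = n) := by
    ext π
    simp only [hF, mem_filter, mem_normLE, mem_primesQ1]
    constructor
    · rintro ⟨⟨-, hQ, hP, -, -⟩, hπn⟩
      refine ⟨⟨hP, hQ, ?_⟩, hπn⟩
      rw [← natAbs_norm_cast π, hπn]
    · rintro ⟨⟨hP, hQ, -⟩, hπn⟩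
      have hnorm : (π.norm : ℝ) = n := by rw [← hcast π, hπn]
      refine ⟨⟨by rw [hnorm]; exact hnS.le, hQ, hP, by rw [hnorm]; exact hRn, by rw [hnorm]; exact hnS⟩,
        hπn⟩
  rw [hfib, mul_sum]
  refine sum_congr rfl fun π hπ ↦ ?_
  have hπn : π.norm.natAbs = n := (mem_filter.mp hπ).2
  have hnormR : (π.norm : ℝ) = n := by rw [← hcast π, hπn]
  have hnormC : (((π.norm : ℝ)) : ℂ) = ((n : ℕ) : ℂ) := by rw [hnormR]; push_cast; rfl
  have hlogC : (Real.log n : ℂ) ≠ 0 := Complex.ofReal_ne_zero.mpr hlogn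
  rw [hnormC, hπn, hnormR, Complex.ofReal_inv]
  calc ((n : ℕ) : ℂ) ^ ((t : ℂ) * I) * angularChar m π
      = ((Real.log n : ℂ))⁻¹ * (Real.log n : ℂ) * (((n : ℕ) : ℂ) ^ ((t : ℂ) * I) * angularChar m π) := by
        rw [inv_mul_cancel₀ hlogC, one_mul]
    _ = ((Real.log n : ℂ))⁻¹ * ((Real.log n : ℂ) * angularChar m π * ((n : ℕ) : ℂ) ^ ((t : ℂ) * I)) := by
        ring

/-- **The trivial bound `‖∑_{R ≤ N(p) < S} N(p)^{it} λ^m(p)‖ ≤ 9S`** (`S ≥ 1`): at most `#{z : N(z) ≤ S}`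
unimodular terms. [folklore] -/
theorem norm_primeCharSum_le {R S : ℝ} (hS : 1 ≤ S) (m : ℕ) (t : ℝ) : ‖primeCharSum R S m t‖ ≤ 9 * S := by
  classical
  unfold primeCharSum
  refine (norm_sum_le _ _).trans ?_
  have hterm : ∀ p ∈ (normLE S).filter (fun p : GaussianInt ↦
      p ∈ firstQuadrant ∧ Prime p ∧ R ≤ (p.norm : ℝ) ∧ (p.norm : ℝ) < S),
      ‖(((p.norm : ℝ)) : ℂ) ^ ((t : ℂ) * I) * angularChar m p‖ ≤ 1 := by
    intro p hp
    obtain ⟨-, -, hP, -, -⟩ := mem_filter.mp hp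
    have hpos : (0 : ℝ) < (p.norm : ℝ) := by
      have := two_le_norm_of_prime hP; exact_mod_cast (by omega : (0 : ℤ) < p.norm)
    rw [norm_mul, norm_angularChar hP.ne_zero, mul_one, Complex.norm_cpow_eq_rpow_re_of_pos hpos]
    simp
  refine (sum_le_sum hterm).trans ?_
  rw [sum_const, nsmul_eq_mul, mul_one]
  -- `#filter ≤ #normLE ⌊S⌋ ≤ 9 ⌊S⌋ ≤ 9 S`
  have hS0 : 0 ≤ S := by linarith
  have hsub : (normLE S).filter (fun p : GaussianInt ↦
      p ∈ firstQuadrant ∧ Prime p ∧ R ≤ (p.norm : ℝ) ∧ (p.norm : ℝ) < S) ⊆ normLE ((⌊S⌋₊ : ℕ) : ℝ) := by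
    intro p hp
    have hle : (p.norm : ℝ) ≤ S := mem_normLE.mp (mem_filter.mp hp).1
    rw [mem_normLE]
    have h1 : p.norm.natAbs ≤ ⌊S⌋₊ := Nat.le_floor (by rw [natAbs_norm_real]; exact hle)
    rw [← natAbs_norm_real]
    exact_mod_cast h1
  have hfl : 1 ≤ ⌊S⌋₊ := Nat.le_floor (by simpa using hS)
  calc ((((normLE S).filter (fun p : GaussianInt ↦
        p ∈ firstQuadrant ∧ Prime p ∧ R ≤ (p.norm : ℝ) ∧ (p.norm : ℝ) < S)).card : ℕ) : ℝ)
      ≤ (normLE ((⌊S⌋₊ : ℕ) : ℝ)).card := by exact_mod_cast card_le_card hsub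
    _ ≤ 9 * (⌊S⌋₊ : ℝ) := card_normLE_le_nine_mul hfl
    _ ≤ 9 * S := by gcongr; exact Nat.floor_le hS0

end GaussianHecke

end Literature.NumberTheory.LFunctions
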